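import Mathlib
import Literature.Geometry.Lorentzian.KerrSchildWaveCauchyProblem

/-!
# Route StarvedNecks — crux `NecksCertify`, line `two-cap-focusing-ledger`: stub M2, wave calculus

Helper file for `stub_huygensNeck` (the Huygens neck lemma).  Elementary calculus of the flat
divergence-form d'Alembertian `□_η u = KerrSchild.waveOperator (fun _ ↦ Kerr.etaComp) u` on smooth
functions `u : E4 → ℝ`:

* `waveEta_eq` — for smooth `u`, `□_η u = ∑_μ η^{μμ} ∂_μ ∂_μ u` (diagonal form, nested `fderiv`);
* `contDiff_waveEta` — `□_η u` is smooth;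
* `waveEta_dir_comm`, `waveEta_iteratedFDeriv_comm` — `□_η` commutes with directional derivatives
  and with `y ↦ Dᵐu(y)·v` (Schwarz, `ContDiffAt.isSymmSndFDerivAt`);
* `waveEta_mul` — the Leibniz rule `□(χu) = χ□u + u□χ + 2∑_μ η^{μμ} ∂_μχ ∂_μu`;
* `norm_iteratedFDeriv_waveEta_le` — `‖Dᵏ(□_η u)(y)‖ ≤ 4‖Dᵏ⁺²u(y)‖`;
* `waveEta_congr`, `waveEta_eq_zero_of_eventuallyEq` — locality.

Mathlib only (plus the tree's definition of `KerrSchild.waveOperator`); no definitions, no named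
facts.
-/

noncomputable section

namespace Summit.FinalStateConjecture.FinalStateConjecture.Theorems.NecksCertifyTwoCap.Huygens

open scoped ContDiff Topology
open Filter Set Literature.Geometry.Lorentzian

set_option linter.dupNamespace false

/-! ### Directional derivatives of smooth functions -/

/-- A directional derivative of a smooth function is smooth. -/
theorem contDiff_dir {u : E4 → ℝ} (hu : ContDiff ℝ ∞ u) (a : E4) :
    ContDiff ℝ ∞ fun y ↦ fderiv ℝ u y a :=
  (hu.fderiv_right (m := ∞) le_rfl).clm_apply contDiff_const

/-- The directional derivative of `y ↦ Du(y)·b` along `a` is `D²u(y)(a)(b)`. -/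
theorem fderiv_dir_apply {u : E4 → ℝ} (hu : ContDiff ℝ ∞ u) (a b y : E4) :
    fderiv ℝ (fun z ↦ fderiv ℝ u z b) y a = fderiv ℝ (fderiv ℝ u) y a b := by
  have hd : DifferentiableAt ℝ (fderiv ℝ u) y :=
    ((hu.fderiv_right (m := ∞) le_rfl).differentiable (by simp)) y
  rw [fderiv_clm_apply hd (differentiableAt_const b)]
  simp

/-- **Schwarz**: directional derivatives of a smooth function commute. -/
theorem dir_comm {u : E4 → ℝ} (hu : ContDiff ℝ ∞ u) (a b : E4) :
    (fun y ↦ fderiv ℝ (fun z ↦ fderiv ℝ u z b) y a) =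
      fun y ↦ fderiv ℝ (fun z ↦ fderiv ℝ u z a) y b := by
  funext y
  rw [fderiv_dir_apply hu a b y, fderiv_dir_apply hu b a y]
  exact (hu.contDiffAt.isSymmSndFDerivAt (by
    simp only [minSmoothness_of_isRCLikeNormedField]; norm_cast)).eq a b

/-! ### The flat d'Alembertian in diagonal form -/

/-- Only the diagonal entries of `η` survive in `∑_ν η^{μν} c_ν`. -/
theorem sum_etaComp_mul (μ : Fin 4) (c : Fin 4 → ℝ) :
    ∑ ν, Kerr.etaComp μ ν * c ν = Kerr.etaComp μ μ * c μ := by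
  rw [Finset.sum_eq_single μ]
  · intro ν _ hν
    simp [Kerr.etaComp, Ne.symm hν]
  · simp

/-- `|η^{μμ}| = 1`. -/
theorem abs_etaComp_diag (μ : Fin 4) : |Kerr.etaComp μ μ| = 1 := by
  simp only [Kerr.etaComp, if_true]
  split_ifs <;> simp

/-- **Diagonal form**: for smooth `u`, `□_η u (y) = ∑_μ η^{μμ} ∂_μ∂_μ u (y)`. -/
theorem waveEta_eq {u : E4 → ℝ} (hu : ContDiff ℝ ∞ u) :
    KerrSchild.waveOperator (fun _ ↦ Kerr.etaComp) u =
      fun y ↦ ∑ μ, Kerr.etaComp μ μ *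
        fderiv ℝ (fun z ↦ fderiv ℝ u z (E4.basisVector μ)) y (E4.basisVector μ) := by
  funext y
  rw [KerrSchild.waveOperator_apply]
  refine Finset.sum_congr rfl fun μ _ ↦ ?_
  have hfun : (fun z ↦ ∑ ν, Kerr.etaComp μ ν * fderiv ℝ u z (E4.basisVector ν)) =
      fun z ↦ Kerr.etaComp μ μ * fderiv ℝ u z (E4.basisVector μ) := by
    funext z
    exact sum_etaComp_mul μ _
  rw [hfun, fderiv_const_mul (((contDiff_dir hu _).differentiable (by simp)) y)]
  simp

/-- For smooth `u`, `□_η u` is smooth. -/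
theorem contDiff_waveEta {u : E4 → ℝ} (hu : ContDiff ℝ ∞ u) :
    ContDiff ℝ ∞ (KerrSchild.waveOperator (fun _ ↦ Kerr.etaComp) u) := by
  rw [waveEta_eq hu]
  exact ContDiff.sum fun μ _ ↦ contDiff_const.mul (contDiff_dir (contDiff_dir hu _) _)

/-- **`□_η` commutes with directional derivatives** (smooth `u`). -/
theorem waveEta_dir_comm {u : E4 → ℝ} (hu : ContDiff ℝ ∞ u) (a : E4) :
    KerrSchild.waveOperator (fun _ ↦ Kerr.etaComp) (fun y ↦ fderiv ℝ u y a) =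
      fun y ↦ fderiv ℝ (KerrSchild.waveOperator (fun _ ↦ Kerr.etaComp) u) y a := by
  rw [waveEta_eq (contDiff_dir hu a), waveEta_eq hu]
  funext y
  have hdiff : ∀ μ : Fin 4, DifferentiableAt ℝ (fun z ↦ Kerr.etaComp μ μ *
      fderiv ℝ (fun w ↦ fderiv ℝ u w (E4.basisVector μ)) z (E4.basisVector μ)) y := fun μ ↦
    ((contDiff_const.mul (contDiff_dir (contDiff_dir hu _) _)).differentiable (by simp)) y
  rw [fderiv_fun_sum fun μ _ ↦ hdiff μ]
  simp only [FunLike.coe_sum, Finset.sum_apply]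
  refine Finset.sum_congr rfl fun μ _ ↦ ?_
  rw [fderiv_const_mul (((contDiff_dir (contDiff_dir hu _) _).differentiable (by simp)) y)]
  simp only [FunLike.coe_smul, Pi.smul_apply, smul_eq_mul]
  congr 1
  -- `∂_μ ∂_μ ∂_a u = ∂_a ∂_μ ∂_μ u`
  have h1 : (fun w ↦ fderiv ℝ (fun y ↦ fderiv ℝ u y a) w (E4.basisVector μ)) =
      fun w ↦ fderiv ℝ (fun y ↦ fderiv ℝ u y (E4.basisVector μ)) w a :=
    dir_comm hu (E4.basisVector μ) a
  rw [h1]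
  have h2 := dir_comm (contDiff_dir hu (E4.basisVector μ)) (E4.basisVector μ) a
  exact congrFun h2 y

/-- **`□_η` commutes with `y ↦ Dᵐu(y)·v`** (smooth `u`). -/
theorem waveEta_iteratedFDeriv_comm {u : E4 → ℝ} (hu : ContDiff ℝ ∞ u) {m : ℕ}
    (v : Fin m → E4) :
    KerrSchild.waveOperator (fun _ ↦ Kerr.etaComp) (fun y ↦ iteratedFDeriv ℝ m u y v) =
      fun y ↦ iteratedFDeriv ℝ m (KerrSchild.waveOperator (fun _ ↦ Kerr.etaComp) u) y v := by
  induction m generalizing u with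
  | zero =>
    simp only [iteratedFDeriv_zero_apply]
  | succ m ih =>
    -- peel off the last vector
    have key : ∀ {w : E4 → ℝ}, ContDiff ℝ ∞ w →
        (fun y ↦ iteratedFDeriv ℝ (m + 1) w y v) =
          fun y ↦ iteratedFDeriv ℝ m (fun z ↦ fderiv ℝ w z (v (Fin.last m))) y (Fin.init v) := by
      intro w hw
      funext y
      rw [iteratedFDeriv_succ_apply_right]
      rw [iteratedFDeriv_clm_apply_const_apply (hw.fderiv_right (m := ∞) le_rfl) (by
        exact_mod_cast le_top)]
    rw [key hu, ih (contDiff_dir hu _), waveEta_dir_comm hu, key (contDiff_waveEta hu)]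

/-! ### Leibniz rule -/

/-- First derivative of a product of smooth functions along `a`. -/
theorem dir_mul {χ u : E4 → ℝ} (hχ : ContDiff ℝ ∞ χ) (hu : ContDiff ℝ ∞ u) (a : E4) :
    (fun y ↦ fderiv ℝ (fun z ↦ χ z * u z) y a) =
      fun y ↦ χ y * fderiv ℝ u y a + u y * fderiv ℝ χ y a := by
  funext y
  rw [fderiv_fun_mul ((hχ.differentiable (by simp)) y) ((hu.differentiable (by simp)) y)]
  simp [smul_eq_mul]

/-- **Leibniz rule for `□_η`**: `□(χu) = χ □u + u □χ + 2 ∑_μ η^{μμ} ∂_μχ ∂_μu` (smooth `χ, u`). -/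
theorem waveEta_mul {χ u : E4 → ℝ} (hχ : ContDiff ℝ ∞ χ) (hu : ContDiff ℝ ∞ u) :
    KerrSchild.waveOperator (fun _ ↦ Kerr.etaComp) (fun y ↦ χ y * u y) =
      fun y ↦ χ y * KerrSchild.waveOperator (fun _ ↦ Kerr.etaComp) u y +
        u y * KerrSchild.waveOperator (fun _ ↦ Kerr.etaComp) χ y +
        2 * ∑ μ, Kerr.etaComp μ μ * fderiv ℝ χ y (E4.basisVector μ) *
          fderiv ℝ u y (E4.basisVector μ) := by
  rw [waveEta_eq (hχ.mul hu), waveEta_eq hu, waveEta_eq hχ]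
  funext y
  rw [Finset.mul_sum, Finset.mul_sum, Finset.mul_sum, ← Finset.sum_add_distrib,
    ← Finset.sum_add_distrib]
  refine Finset.sum_congr rfl fun μ _ ↦ ?_
  set e := E4.basisVector μ
  have hχ1 := contDiff_dir hχ e
  have hu1 := contDiff_dir hu e
  rw [dir_mul hχ hu e]
  have hsplit : (fun y ↦ χ y * fderiv ℝ u y e + u y * fderiv ℝ χ y e) =
      (fun y ↦ χ y * fderiv ℝ u y e) + fun y ↦ u y * fderiv ℝ χ y e := rfl
  rw [hsplit, fderiv_add (((hχ.mul hu1).differentiable (by simp)) y)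
    (((hu.mul hχ1).differentiable (by simp)) y)]
  simp only [_root_.add_apply]
  rw [congrFun (dir_mul hχ hu1 e) y, congrFun (dir_mul hu hχ1 e) y]
  ring

/-! ### Norm bounds -/

/-- `‖Dᵏ(y ↦ Du(y)·a)(y)‖ ≤ ‖a‖ ‖Dᵏ⁺¹u(y)‖`. -/
theorem norm_iteratedFDeriv_dir_le {u : E4 → ℝ} (hu : ContDiff ℝ ∞ u) (a : E4) (k : ℕ) (y : E4) :
    ‖iteratedFDeriv ℝ k (fun z ↦ fderiv ℝ u z a) y‖ ≤ ‖a‖ * ‖iteratedFDeriv ℝ (k + 1) u y‖ := by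
  have h := norm_iteratedFDeriv_clm_apply_const (f := fderiv ℝ u) (c := a) (x := y) (N := ∞)
    (n := k) ((hu.fderiv_right (m := ∞) le_rfl).contDiffAt) (by exact_mod_cast le_top)
  rwa [norm_iteratedFDeriv_fderiv] at h

/-- The coordinate vectors have norm one. -/
theorem norm_basisVector (μ : Fin 4) : ‖E4.basisVector μ‖ = 1 := by
  simp [E4.basisVector]

/-- **`‖Dᵏ(□_η u)(y)‖ ≤ 4 ‖Dᵏ⁺²u(y)‖`** for smooth `u`. -/
theorem norm_iteratedFDeriv_waveEta_le {u : E4 → ℝ} (hu : ContDiff ℝ ∞ u) (k : ℕ) (y : E4) :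
    ‖iteratedFDeriv ℝ k (KerrSchild.waveOperator (fun _ ↦ Kerr.etaComp) u) y‖ ≤
      4 * ‖iteratedFDeriv ℝ (k + 2) u y‖ := by
  rw [waveEta_eq hu]
  have hsm : ∀ μ : Fin 4, ContDiff ℝ ∞ fun z ↦
      fderiv ℝ (fun w ↦ fderiv ℝ u w (E4.basisVector μ)) z (E4.basisVector μ) :=
    fun μ ↦ contDiff_dir (contDiff_dir hu _) _
  have hterm : ∀ μ : Fin 4, ‖iteratedFDeriv ℝ k (fun z ↦ Kerr.etaComp μ μ *
      fderiv ℝ (fun w ↦ fderiv ℝ u w (E4.basisVector μ)) z (E4.basisVector μ)) y‖ ≤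
      ‖iteratedFDeriv ℝ (k + 2) u y‖ := by
    intro μ
    have hs : (fun z ↦ Kerr.etaComp μ μ *
        fderiv ℝ (fun w ↦ fderiv ℝ u w (E4.basisVector μ)) z (E4.basisVector μ)) =
        Kerr.etaComp μ μ • fun z ↦
          fderiv ℝ (fun w ↦ fderiv ℝ u w (E4.basisVector μ)) z (E4.basisVector μ) := by
      funext z; simp [smul_eq_mul]
    rw [hs, iteratedFDeriv_const_smul_apply
      (((hsm μ).of_le (by exact_mod_cast le_top)).contDiffAt (n := (k : ℕ∞ω))),
      norm_smul, Real.norm_eq_abs, abs_etaComp_diag, one_mul]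
    calc ‖iteratedFDeriv ℝ k (fun z ↦
            fderiv ℝ (fun w ↦ fderiv ℝ u w (E4.basisVector μ)) z (E4.basisVector μ)) y‖
        ≤ ‖E4.basisVector μ‖ *
            ‖iteratedFDeriv ℝ (k + 1) (fun w ↦ fderiv ℝ u w (E4.basisVector μ)) y‖ :=
          norm_iteratedFDeriv_dir_le (contDiff_dir hu _) _ k y
      _ ≤ ‖E4.basisVector μ‖ * (‖E4.basisVector μ‖ * ‖iteratedFDeriv ℝ (k + 1 + 1) u y‖) := by
          gcongr
          exact norm_iteratedFDeriv_dir_le hu _ (k + 1) y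
      _ = ‖iteratedFDeriv ℝ (k + 2) u y‖ := by rw [norm_basisVector, one_mul, one_mul]
  calc ‖iteratedFDeriv ℝ k (fun y ↦ ∑ μ, Kerr.etaComp μ μ *
          fderiv ℝ (fun z ↦ fderiv ℝ u z (E4.basisVector μ)) y (E4.basisVector μ)) y‖
      = ‖∑ μ, iteratedFDeriv ℝ k (fun y ↦ Kerr.etaComp μ μ *
          fderiv ℝ (fun z ↦ fderiv ℝ u z (E4.basisVector μ)) y (E4.basisVector μ)) y‖ := by
        rw [iteratedFDeriv_fun_sum_apply fun μ _ ↦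
          ((contDiff_const.mul (hsm μ)).of_le (by exact_mod_cast le_top)).contDiffAt]
    _ ≤ ∑ μ, ‖iteratedFDeriv ℝ k (fun y ↦ Kerr.etaComp μ μ *
          fderiv ℝ (fun z ↦ fderiv ℝ u z (E4.basisVector μ)) y (E4.basisVector μ)) y‖ := norm_sum_le _ _
    _ ≤ ∑ _μ : Fin 4, ‖iteratedFDeriv ℝ (k + 2) u y‖ := Finset.sum_le_sum fun μ _ ↦ hterm μ
    _ = 4 * ‖iteratedFDeriv ℝ (k + 2) u y‖ := by simp

/-! ### Locality -/

/-- **Locality of `□_η`**: functions agreeing near `x` have the same `□_η` at `x`. -/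
theorem waveEta_congr {u w : E4 → ℝ} {x : E4} (h : u =ᶠ[𝓝 x] w) :
    KerrSchild.waveOperator (fun _ ↦ Kerr.etaComp) u x =
      KerrSchild.waveOperator (fun _ ↦ Kerr.etaComp) w x := by
  have h' : ∀ᶠ y in 𝓝 x, u =ᶠ[𝓝 y] w := h.eventually_nhds
  rw [KerrSchild.waveOperator_apply, KerrSchild.waveOperator_apply]
  refine Finset.sum_congr rfl fun μ _ ↦ ?_
  have hμ : (fun y ↦ ∑ ν, Kerr.etaComp μ ν * fderiv ℝ u y (E4.basisVector ν)) =ᶠ[𝓝 x]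
      fun y ↦ ∑ ν, Kerr.etaComp μ ν * fderiv ℝ w y (E4.basisVector ν) := by
    filter_upwards [h'] with y hy
    simp only [hy.fderiv_eq]
  rw [hμ.fderiv_eq]

/-- A function vanishing near `x` has `□_η = 0` at `x`. -/
theorem waveEta_eq_zero_of_eventuallyEq {u : E4 → ℝ} {x : E4} (h : u =ᶠ[𝓝 x] fun _ ↦ 0) :
    KerrSchild.waveOperator (fun _ ↦ Kerr.etaComp) u x = 0 := by
  rw [waveEta_congr h, KerrSchild.waveOperator_apply]
  simp

/-! ### Registered sub-goal -/

/-- Registered sub-goal of `stub_huygensNeck` (wave calculus): `□_η` commutes with `y ↦ Dᵐu(y)·v`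
for smooth `u`. -/
theorem stub_huygensNeck_waveComm : ∀ (u : E4 → ℝ), ContDiff ℝ ∞ u → ∀ (m : ℕ) (v : Fin m → E4), KerrSchild.waveOperator (fun _ ↦ Kerr.etaComp) (fun y ↦ iteratedFDeriv ℝ m u y v) = fun y ↦ iteratedFDeriv ℝ m (KerrSchild.waveOperator (fun _ ↦ Kerr.etaComp) u) y v :=
  fun _ hu _ v ↦ waveEta_iteratedFDeriv_comm hu v

end Summit.FinalStateConjecture.FinalStateConjecture.Theorems.NecksCertifyTwoCap.Huygens
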